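import Literature.NumberTheory.LFunctions.ThetaChainFreeCheck
import HarnessLib

/-!
# Schoenfeld's `θ`-bound on `[599, 10⁸]` by kernel computation: data-free run, chunk 3 of 35

Topic: `Literature/NumberTheory/LFunctions`. Pure proof file (a kernel computation; nothing is
asserted, no definition). The theorems below evaluate `ThetaChain.runFree` — together `150000`
data-free steps of the certified `θ`-chain (`ThetaChain.stepFree`, `ThetaChainFreeCheck.lean`: the
next prime found and certified by two gcds with the primorials of the odd primes `≤ 2999` and in
`(2999, 10007]`, the enclosures of `log p` and `θ(p)`, and the two comparisons behind
`|θ(x) − x| ≤ √x log² x/(8π)`) — from the state at the prime `13757203` to the state at the prime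
`16236541`. Soundness: `ThetaChain.runFree_sound`; assembly of the 35 chunks: `ThetaUpTo1e8.lean`.
The expected states were obtained by evaluating a twin of the same function outside the kernel
(validated bit-for-bit on the tree's chunk `ThetaChainRun.xrun14`). Declarations of `5·10⁴` steps
(about `70 s` of kernel time each; the kernel's evaluation is linear within a declaration of this size),
`decide +kernel`, standard axioms only (`maxHeartbeats 0` lifts the deterministic time-out).

## References

* L. Schoenfeld, *Sharper bounds for the Chebyshev functions θ(x) and ψ(x). II*, Math. Comp. 30
  (1976), 337–360, Thm. 10 (6.3). [Schoenfeld1976]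
* J. B. Rosser, L. Schoenfeld, *Approximate formulas for some functions of prime numbers*,
  Illinois J. Math. 6 (1962), 64–94, Thms. 18–19 (`θ`-tables to `10⁸`). [RosserSchoenfeld1962]
-/

namespace Literature.NumberTheory.LFunctions.ThetaChainRun

open ThetaChain

set_option maxHeartbeats 0 in
/-- **Data-free certified `θ`-run, chunk 3a** (steps `300001`–`350000` after `8886113`: 50000 primes,
`13757203` to `14580221`). [cite: Schoenfeld1976, Thm. 10 (6.3)] -/
theorem frun3a :
    runFree 50000
      ⟨13757203, 19871202068828103658416541, 19871202068828579284541303, 16626673679039262735725333657365, 16626673679039688574138203692099⟩ =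
    some ⟨14580221, 19941444700050447143590237, 19941444700050922770742804, 17622007292739204037396074862346, 17622007292739653657140880409835⟩ := by
  decide +kernel

set_option maxHeartbeats 0 in
/-- **Data-free certified `θ`-run, chunk 3b** (steps `350001`–`400000` after `8886113`: 50000 primes,
`14580221` to `15408467`). [cite: Schoenfeld1976, Thm. 10 (6.3)] -/
theorem frun3b :
    runFree 50000
      ⟨14580221, 19941444700050447143590237, 19941444700050922770742804, 17622007292739204037396074862346, 17622007292739653657140880409835⟩ =
    some ⟨15408467, 20008239398176147819544792, 20008239398176623447719989, 18620762876362228302512091867382, 18620762876362701703640136359926⟩ := by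
  decide +kernel

set_option maxHeartbeats 0 in
/-- **Data-free certified `θ`-run, chunk 3c** (steps `400001`–`450000` after `8886113`: 50000 primes,
`15408467` to `16236541`). [cite: Schoenfeld1976, Thm. 10 (6.3)] -/
theorem frun3c :
    runFree 50000
      ⟨15408467, 20008239398176147819544792, 20008239398176623447719989, 18620762876362228302512091867382, 18620762876362701703640136359926⟩ =
    some ⟨16236541, 20071523226538725649969392, 20071523226539201279164219, 19622768331557846030042704190498, 19622768331558343212605000759507⟩ := by
  decide +kernel

end Literature.NumberTheory.LFunctions.ThetaChainRun
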